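import Summits.MatrixMultiplication.MatrixMultiplication.Theorems.SoloInformedCwTwoOrientHall

/-!
# Demotion of a pair to two singletons (solo-informed, gen 13; CLAIMS c161)

For a mixed system `(s, d ; t)` with `p + 1` pairs, DEMOTING the last pair means regarding its digits
`s_p, d_p` as two further singletons: the system `(s|_p, d|_p ; t, s_p, d_p)` with `p` pairs and `q + 2`
singletons.  The two systems have literally the same words (the letters `0, s, d, s+d` of the last pair are the
four subsets of `{s_p, d_p}`) and the same cost `σ`; the only difference is that the demoted system may not trade
the letter `s_p + d_p`.  Hence every (oriented) system of distinct representatives of the demoted system is one of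
the full system, for EITHER orientation of the last pair:

* `hallSix_of_demote`        : `HallSix (demoted) → HallSix (full)`;
* `orientedHallSix_of_demote` : `OrientedHallSix (demoted) o → OrientedHallSix (full) (Fin.snoc o b)` for all `b`.

Consequently `W(full) ⊇ W(demoted) × {T, U}` for the sets of working orientations, which is the mechanism behind
the extremal working sets `{o : o₁ ≠ o₂} ⊂ {T,U}^3` observed at `p = 3`, and reduces HALF-ORIENT / CONJECTURE L by
induction on `p` to RIGID systems (no demotion is a mixed design); see the solo-informed paper §2h(17)(c).

Standard axioms only.
-/

namespace Summit.MatrixMultiplication.MatrixMultiplication.Theorems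

open Finset

/-- The singleton digits of the demoted system: `t` followed by `s_p, d_p`. -/
def demoteT {p q : ℕ} (s d : Fin (p + 1) → ℕ) (t : Fin q → ℕ) : Fin (q + 2) → ℕ :=
  Fin.append t ![s (Fin.last p), d (Fin.last p)]

/-- The two new singleton positions used by a letter of the demoted pair: `0 ↦ ∅`, `s ↦ {q}`, `d ↦ {q+1}`,
`s+d ↦ {q, q+1}`. -/
def demoteExtra (q : ℕ) : Fin 4 → Finset (Fin (q + 2)) :=
  ![∅, {Fin.natAdd q 0}, {Fin.natAdd q 1}, {Fin.natAdd q 0, Fin.natAdd q 1}]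

/-- The embedding of the old singleton positions. -/
def demoteEmb (q : ℕ) : Fin q ↪ Fin (q + 2) := ⟨Fin.castAdd 2, Fin.castAdd_injective q 2⟩

/-- The word of the demoted system corresponding to a word of the full system. -/
def demoteWord {p q : ℕ} (m : HWord (p + 1) q) : HWord p (q + 2) :=
  (fun i => m.1 i.castSucc, m.2.map (demoteEmb q) ∪ demoteExtra q (m.1 (Fin.last p)))

/-- The two new singleton positions are distinct. -/
lemma natAdd_zero_ne_one (q : ℕ) : (Fin.natAdd q (0 : Fin 2)) ≠ Fin.natAdd q 1 := by
  simp [Fin.ext_iff]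

/-- The new positions have index at least `q`. -/
lemma le_val_of_mem_demoteExtra {q : ℕ} (ℓ : Fin 4) (x : Fin (q + 2)) (hx : x ∈ demoteExtra q ℓ) :
    q ≤ x.val := by
  fin_cases ℓ <;> simp [demoteExtra] at hx <;> rcases hx with rfl | rfl <;> simp

/-- Old positions are never among the new ones. -/
lemma castAdd_not_mem_demoteExtra {q : ℕ} (ℓ : Fin 4) (i : Fin q) :
    Fin.castAdd 2 i ∉ demoteExtra q ℓ := by
  intro h
  have := le_val_of_mem_demoteExtra ℓ _ h
  simp at this
  omega

/-- New positions are never in the image of the old ones. -/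
lemma natAdd_not_mem_map {q : ℕ} (S : Finset (Fin q)) (j : Fin 2) :
    Fin.natAdd q j ∉ S.map (demoteEmb q) := by
  intro h
  obtain ⟨a, -, ha⟩ := Finset.mem_map.1 h
  have := congrArg Fin.val ha
  simp [demoteEmb] at this
  omega

/-- The old part and the new part of a demoted singleton set are disjoint. -/
lemma disjoint_map_demoteExtra {q : ℕ} (S : Finset (Fin q)) (ℓ : Fin 4) :
    Disjoint (S.map (demoteEmb q)) (demoteExtra q ℓ) := by
  refine Finset.disjoint_left.2 ?_
  intro x hx hx'
  obtain ⟨a, -, rfl⟩ := Finset.mem_map.1 hx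
  exact castAdd_not_mem_demoteExtra ℓ a hx'

/-- Position `q` (the digit `s_p`) is used exactly by the letters `s` and `s+d`. -/
lemma natAdd_zero_mem_demoteExtra {q : ℕ} (ℓ : Fin 4) :
    Fin.natAdd q 0 ∈ demoteExtra q ℓ ↔ (ℓ = 1 ∨ ℓ = 3) := by
  have h := natAdd_zero_ne_one q
  fin_cases ℓ <;> simp [demoteExtra, h]

/-- Position `q+1` (the digit `d_p`) is used exactly by the letters `d` and `s+d`. -/
lemma natAdd_one_mem_demoteExtra {q : ℕ} (ℓ : Fin 4) :
    Fin.natAdd q 1 ∈ demoteExtra q ℓ ↔ (ℓ = 2 ∨ ℓ = 3) := by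
  have h := (natAdd_zero_ne_one q).symm
  fin_cases ℓ <;> simp [demoteExtra, h]

/-- The singleton sum over the two new positions is the letter value of the demoted pair. -/
lemma sum_demoteExtra {p q : ℕ} (s d : Fin (p + 1) → ℕ) (t : Fin q → ℕ) (ℓ : Fin 4) :
    ∑ i ∈ demoteExtra q ℓ, demoteT s d t i =
      (![0, s (Fin.last p), d (Fin.last p), s (Fin.last p) + d (Fin.last p)] : Fin 4 → ℕ) ℓ := by
  have h := natAdd_zero_ne_one q
  have h0 : demoteT s d t (Fin.natAdd q 0) = s (Fin.last p) := by simp [demoteT]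
  have h1 : demoteT s d t (Fin.natAdd q 1) = d (Fin.last p) := by simp [demoteT]
  fin_cases ℓ <;> simp [demoteExtra, Finset.sum_pair h, h0, h1]

/-- `demoteWord` is injective. -/
lemma demoteWord_injective (p q : ℕ) : Function.Injective (demoteWord (p := p) (q := q)) := by
  classical
  intro m₁ m₂ h
  have h1 : (fun i : Fin p => m₁.1 i.castSucc) = fun i => m₂.1 i.castSucc := congrArg Prod.fst h
  have h2 : m₁.2.map (demoteEmb q) ∪ demoteExtra q (m₁.1 (Fin.last p)) =
      m₂.2.map (demoteEmb q) ∪ demoteExtra q (m₂.1 (Fin.last p)) := congrArg Prod.snd h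
  -- the old singleton subsets agree
  have hS : m₁.2 = m₂.2 := by
    ext i
    have := congrArg (fun T => Fin.castAdd 2 i ∈ T) h2
    simp only [Finset.mem_union, castAdd_not_mem_demoteExtra, or_false] at this
    have e : ∀ S : Finset (Fin q), Fin.castAdd 2 i ∈ S.map (demoteEmb q) ↔ i ∈ S := fun S => by
      constructor
      · intro hi
        obtain ⟨a, ha, hai⟩ := Finset.mem_map.1 hi
        have : a = i := Fin.castAdd_injective q 2 (by simpa [demoteEmb] using hai)
        exact this ▸ ha
      · intro hi
        exact Finset.mem_map.2 ⟨i, hi, rfl⟩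
    simpa [e] using this
  -- the last letters agree
  have hℓ : m₁.1 (Fin.last p) = m₂.1 (Fin.last p) := by
    have a := congrArg (fun T => Fin.natAdd q 0 ∈ T) h2
    have b := congrArg (fun T => Fin.natAdd q 1 ∈ T) h2
    simp only [Finset.mem_union, natAdd_not_mem_map, false_or, natAdd_zero_mem_demoteExtra,
      natAdd_one_mem_demoteExtra, eq_iff_iff] at a b
    have key : ∀ x y : Fin 4, ((x = 1 ∨ x = 3) ↔ (y = 1 ∨ y = 3)) → ((x = 2 ∨ x = 3) ↔ (y = 2 ∨ y = 3)) →
        x = y := by decide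
    exact key _ _ a b
  refine Prod.ext (funext fun k => ?_) hS
  cases k using Fin.lastCases with
  | last => exact hℓ
  | cast i => exact congrFun h1 i

/-- The cost is unchanged by demotion. -/
lemma mixedSigma_demote {p q : ℕ} (s d : Fin (p + 1) → ℕ) (t : Fin q → ℕ) :
    mixedSigma (fun i : Fin p => s i.castSucc) (fun i => d i.castSucc) (demoteT s d t) = mixedSigma s d t := by
  have h1 : ∑ i : Fin (q + 2), demoteT s d t i = (∑ i, t i) + (s (Fin.last p) + d (Fin.last p)) := by
    rw [Fin.sum_univ_add]
    simp [demoteT, Fin.sum_univ_two]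
  have h2 : ∑ k : Fin (p + 1), (s k + d k) =
      ∑ i : Fin p, (s i.castSucc + d i.castSucc) + (s (Fin.last p) + d (Fin.last p)) :=
    Fin.sum_univ_castSucc _
  unfold mixedSigma
  rw [h1, h2]
  ring

/-- The representative values agree: the full word with the last pair untraded (choice code `1`) has the value of
the demoted word. -/
lemma candVal_demote {p q : ℕ} (s d : Fin (p + 1) → ℕ) (t : Fin q → ℕ) (m : HWord (p + 1) q)
    (e : Fin p → Fin 3) :
    candVal s d t m (Fin.snoc (α := fun _ => Fin 3) e 1) =
      candVal (fun i : Fin p => s i.castSucc) (fun i => d i.castSucc) (demoteT s d t) (demoteWord m) e := by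
  have hsum : ∑ i ∈ (demoteWord m).2, demoteT s d t i =
      (∑ i ∈ m.2, t i) + (![0, s (Fin.last p), d (Fin.last p), s (Fin.last p) + d (Fin.last p)] : Fin 4 → ℕ)
        (m.1 (Fin.last p)) := by
    simp only [demoteWord]
    rw [Finset.sum_union (disjoint_map_demoteExtra _ _), Finset.sum_map, sum_demoteExtra]
    simp [demoteEmb, demoteT]
  have hlast : (if m.1 (Fin.last p) = 3 then
        (![2 * s (Fin.last p), s (Fin.last p) + d (Fin.last p), 2 * d (Fin.last p)] : Fin 3 → ℕ)
          ((Fin.snoc (α := fun _ => Fin 3) e 1 : Fin (p + 1) → Fin 3) (Fin.last p))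
      else (![0, s (Fin.last p), d (Fin.last p), s (Fin.last p) + d (Fin.last p)] : Fin 4 → ℕ)
        (m.1 (Fin.last p))) =
      (![0, s (Fin.last p), d (Fin.last p), s (Fin.last p) + d (Fin.last p)] : Fin 4 → ℕ)
        (m.1 (Fin.last p)) := by
    by_cases h3 : m.1 (Fin.last p) = 3
    · simp [h3]
    · simp [h3]
  unfold candVal
  rw [Fin.sum_univ_castSucc, hlast, hsum]
  simp only [Fin.snoc_castSucc, demoteWord]
  ring

/-- **Demotion lemma (unoriented).** HALL-6 for the demoted system gives HALL-6 for the full system. -/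
theorem hallSix_of_demote {p q : ℕ} (s d : Fin (p + 1) → ℕ) (t : Fin q → ℕ)
    (h : HallSix (fun i : Fin p => s i.castSucc) (fun i => d i.castSucc) (demoteT s d t)) :
    HallSix s d t := by
  obtain ⟨ε, hle, hinj⟩ := h
  refine ⟨fun m => Fin.snoc (α := fun _ => Fin 3) (ε (demoteWord m)) 1, fun m => ?_, fun m₁ m₂ hm => ?_⟩
  · rw [candVal_demote, ← mixedSigma_demote s d t]; exact hle _
  · have h' := hm
    simp only [candVal_demote] at h'
    exact demoteWord_injective p q (hinj h')

/-- **Demotion lemma (oriented).** A working orientation of the demoted system extends to a working orientation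
of the full system by EITHER orientation of the demoted pair: `W(full) ⊇ W(demoted) × {T, U}`. -/
theorem orientedHallSix_of_demote {p q : ℕ} (s d : Fin (p + 1) → ℕ) (t : Fin q → ℕ) (o : Fin p → Bool)
    (b : Bool)
    (h : OrientedHallSix (fun i : Fin p => s i.castSucc) (fun i => d i.castSucc) (demoteT s d t) o) :
    OrientedHallSix s d t (Fin.snoc o b) := by
  obtain ⟨ε, hor, hle, hinj⟩ := h
  refine ⟨fun m => Fin.snoc (α := fun _ => Fin 3) (ε (demoteWord m)) 1, fun m k => ?_, fun m => ?_,
    fun m₁ m₂ hm => ?_⟩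
  · cases k using Fin.lastCases with
    | last => left; simp
    | cast i =>
      simp only [Fin.snoc_castSucc]
      exact hor (demoteWord m) i
  · rw [candVal_demote, ← mixedSigma_demote s d t]; exact hle _
  · have h' := hm
    simp only [candVal_demote] at h'
    exact demoteWord_injective p q (hinj h')

end Summit.MatrixMultiplication.MatrixMultiplication.Theorems
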